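import Summits.BirchSwinnertonDyer.BirchSwinnertonDyer.Theorems.CMKolyvaginAtInertTwoAnnihilatorAtTwoOfPrintedInputs
import Summits.BirchSwinnertonDyer.BirchSwinnertonDyer.Theorems.CMKolyvaginAtInertTwoDescentAtTwoPowRoute
import Summits.BirchSwinnertonDyer.BirchSwinnertonDyer.Theorems.CMKolyvaginAtInertTwoCMExactDescentAtTwo
import Literature.NumberTheory.EllipticCurves.SelmerProofs
import HarnessLib

/-!
# Route `CMKolyvaginAtInertTwo`, crux `CMKolyvaginExactAtInertTwo` (stmt-BirchSwinnertonDyer-24277):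
# KOLYVAGIN'S THEOREM AT `p = 2` ON H₂ IN THE CRUX'S CURRENCY, MODULO PRINT —
# `2^{M₀} ∥ y_K` in `E(K[1])` ⟹ `2^{2M₀+2} · Ш(E/K)[2^∞] = 0`

Seat `bsd-line-cmk2-p1` g9 (cell `bsd-print-cf2`); helper (`--supports stmt-BirchSwinnertonDyer-24277`).
THEOREMS ONLY (no definition, no named fact, no instance, no `sorry`); no item is closed; BSD is not
proved by this.

The crux `CMKolyvaginExactAtInertTwo` asks for the ORDER `#Ш(E/K)[2^∞] = 4^{M₀}`; Kolyvagin's method gives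
an ANNIHILATOR. This file states the annihilator in the items' own currency (frame `Dt, β, ι, d₁`, `M₀`
measured by `2`-divisibility of `y_K = d₁.derivedPoint` in `E(K[1])`) for EVERY `M₀`, with every binder
that is not print DISCHARGED: `…AnnihilatorAtTwoOfPrintedInputs` (this seat: g7's level-`2^M` annihilator
with the point system, the reciprocity family, the Cartan binder and Gross 5.3 discharged) + the
`M₀`-clause conversions `E(K[1]) ↔ E(K)` (g0 `CMExactDescent.eq_zero_of_two_pow_smul_eq_zero_ringClassField`,
`X11b.Three.Koly.pDiv_one_iff_exists_zsmul_eq`, g7 `two_pow_smul_ne_of_not_divisible_ringClassField`) +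
the Kummer sequence (`map_torsionH1ToH1_selmerGroup_holds`, `torsionH1ToH1_kummerMapTorsion`).

* `sha_two_pow_smul_eq_zero_of_cmInert_of_printedInputs` — ON H₂ (`HasCM`, `CMInert W 2`, `ρ̄₂` onto,
  globally minimal), `K` imaginary quadratic with odd `d_K ≠ −3` and the Heegner hypothesis for `N_E`, a
  frame `Dt, β, ι, d₁` with `y_K` of infinite order, `2^{M₀} ∣ y_K` and `2^{M₀+1} ∤ y_K` in `E(K[1])`:
  GIVEN the named fact `prop37_2_reductionCongruence_inert N_E W K` (Gross 3.7 (2)) and the printed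
  `hGZ31` (Gross–Zagier III (3.1)), **every `2`-power-torsion class of `Ш(E/K)` is killed by `2^{2M₀+2}`**
  (so `Ш(E/K)[2^∞]` has exponent `≤ 2M₀ + 2`; with its finiteness — `Sel_{2^M}` finite — bounded order).

HONEST FRAMING: composition of tree theorems, conditional on the displayed prints; the upper bound is
Kolyvagin's annihilator with the known `2`-adic loss (memo v6: `2M₀ + 2` vs the conjectured order `4^{M₀}`),
NOT the crux's exactness. Beyond print: Kolyvagin 1989 Thm. B / McCallum Thm. exclude `p = 2`; no printed
counterpart of the statement; no new mathematics claimed. BSD is not proved by this.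

References: [Kolyvagin1989Izv] Thm. B, §3; [GrossLMS1991] §1 Thm. 1.3, §§3–6, §10; [McCallumLMS1991] §1,
§5 Lemma 5.1; [GrossZagier1986] III (3.1); [SilvermanAEC2009] X Thm. 4.2 (a).
-/

-- single-conjunct summit: `Summit.BirchSwinnertonDyer.BirchSwinnertonDyer.…` repeats the name by design
set_option linter.dupNamespace false
set_option autoImplicit false

noncomputable section

open scoped Classical
open WeierstrassCurve Field NumberField IsDedekindDomain Finset
open Literature.NumberTheory.EllipticCurves Literature.NumberTheory.GaloisRepresentations
open Literature.NumberTheory.EllipticCurves.KolyvaginCocycle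
open Literature.NumberTheory.EllipticCurves.RingClassField
open Literature.NumberTheory.EllipticCurves.ModularForms
open Literature.NumberTheory.EllipticCurves.Rank1Residual (CMInert)
open Summit.BirchSwinnertonDyer.Rank1Residual.X11b

namespace Summit.BirchSwinnertonDyer.BirchSwinnertonDyer.Theorems.KolyvaginDescentTwo

-- `K : Type`: the tree's ring-class class field theory is universe `0`.
variable (W : WeierstrassCurve ℚ) {K : Type} [Field K] [NumberField K]

/-- **KOLYVAGIN'S THEOREM AT `2` ON H₂, MODULO PRINT, IN THE CRUX'S CURRENCY**: `2^{M₀} ∥ y_K` in `E(K[1])`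
⟹ `2^{2M₀+2}` kills every `2`-power-torsion class of `Ш(E/K)` (module docstring).
[cite: Kolyvagin1989Izv, Thm. B and §3] [cite: GrossLMS1991, §1 Thm. 1.3 (2), §10]
[cite: McCallumLMS1991, §1 Theorem, §5 Lemma 5.1] [cite: GrossZagier1986, III (3.1)] -/
theorem sha_two_pow_smul_eq_zero_of_cmInert_of_printedInputs [W.IsElliptic] [W.IsGloballyMinimal]
    [NeZero (W.conductorNorm ℤ)] (hCM : W.HasCM) (hin : CMInert W 2)
    (hsurj : W.HasSurjectiveModNGaloisRep 2) (hK : IsImaginaryQuadratic K)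
    (hodd : Odd (NumberField.discr K)) (h3 : NumberField.discr K ≠ -3)
    (hH : SatisfiesHeegnerHypothesis (W.conductorNorm ℤ) K)
    (Dt : ModularParametrizationData W (W.conductorNorm ℤ)) (β : ℤ) (ι : K →+* ℂ)
    (d₁ : KolyvaginHeegnerData Dt β ι 1) (hy : ¬ IsOfFinAddOrder d₁.derivedPoint) (M₀ : ℕ)
    (hdiv₁ : ∃ Q : (W.baseChange (ringClassField K ι 1)).toAffine.Point,
      ((2 ^ M₀ : ℕ) : ℤ) • Q = d₁.derivedPoint)
    (hndiv₁ : ¬ ∃ Q : (W.baseChange (ringClassField K ι 1)).toAffine.Point,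
      ((2 ^ (M₀ + 1) : ℕ) : ℤ) • Q = d₁.derivedPoint)
    (h372 : GrossLMS1991.prop37_2_reductionCongruence_inert (W.conductorNorm ℤ) W K)
    (hGZ31 : ∀ [W.IsElliptic] (_hK : IsImaginaryQuadratic K) (_hH : SatisfiesHeegnerHypothesis (W.conductorNorm ℤ) K)
      (Dt : ModularParametrizationData W (W.conductorNorm ℤ)) (β : ℤ) (ι : K →+* ℂ) {M : ℕ} (_hM : 1 ≤ M) {n : ℕ}
      (_hn : Squarefree n)
      (_hKol : ∀ q ∈ n.primeFactors, IsKolyvaginPrime (W.conductorNorm ℤ) W K 2 q ∧ FrobEqFrobInfty W K (2 ^ M) q)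
      (d : (m : ℕ) → m ∣ n → KolyvaginHeegnerData Dt β ι m),
      ∃ n' : ℤ, IsCoprime ((2 ^ M : ℕ) : ℤ) n' ∧
        ∀ (m : ℕ) (hm : m ∣ n) (γ : ringClassField K ι m ≃ₐ[ℚ] ringClassField K ι m),
          γ ∈ ringClassGal ι m → ∀ v : HeightOneSpectrum (𝓞 K),
            ¬ (W.baseChange K).HasGoodReductionAt v →
            n' • pointsMap (W.baseChange K) (v.adicCompletion K)
                ((d m hm).toGeomPoints (pointGalHom W (ringClassField K ι m) γ (d m hm).y)) ∈
              E0Receptacle (W.baseChange K) v ∧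
            ∀ (ℓ : ℕ) (hℓ : ℓ ∈ m.primeFactors)
              (hle : ringClassField K ι (m / ℓ) ≤ ringClassField K ι m),
              n' • pointsMap (W.baseChange K) (v.adicCompletion K)
                  ((d m hm).toGeomPoints (pointGalHom W (ringClassField K ι m) γ
                    (WeierstrassCurve.Affine.Point.map (W' := W)
                      ((RingClassField.inclusion ι hle).restrictScalars ℚ)
                      (d (m / ℓ)
                        ((Nat.div_dvd_of_dvd (Nat.dvd_of_mem_primeFactors hℓ)).trans hm)).y))) ∈
                E0Receptacle (W.baseChange K) v)
    (d : (W.baseChange K).sha) (hd : ∃ j : ℕ, 2 ^ j • d = 0) :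
    2 ^ (2 * M₀ + 2) • d = 0 := by
  haveI : Fact (Nat.Prime 2) := ⟨Nat.prime_two⟩
  haveI hEK : (W.baseChange K).IsElliptic := inferInstanceAs (W.map (algebraMap ℚ K)).IsElliptic
  obtain ⟨j, hj⟩ := hd
  -- the Heegner point `P₀ ∈ E(K)` below `y_K`, of infinite order; the conjugation `c`
  obtain ⟨P₀, Hd, hP₀, hP₀K⟩ := CMExactDescent.exists_heegnerPoint_map_eq_derivedPoint_one hK hH d₁
  have hheeg : IsHeegnerPoint (W.conductorNorm ℤ) W K P₀ := ⟨Dt, Hd, ι, hP₀⟩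
  have hPinf : ¬ IsOfFinAddOrder P₀ := by
    intro hfin
    apply hy
    rw [← hP₀K]
    exact (WeierstrassCurve.Affine.Point.map (W' := W)
      (algebraMap K (ringClassField K ι 1)).toRatAlgHom).isOfFinAddOrder hfin
  obtain ⟨c, hc, -⟩ := exists_conj_of_isImaginaryQuadratic (K := K) hK
  -- the level `2^M`, `M = j + M₀ + 1`, and `a = M − 1 − M₀ = j`
  set M : ℕ := j + M₀ + 1 with hMdef
  have hM : 1 ≤ M := by omega
  have hdivM : ∀ Q : geomPoints (W.baseChange K), ∃ R, ((2 ^ M : ℕ) : ℤ) • R = Q := fun Q ↦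
    (W.baseChange K).zsmul_geomPoints_surjective_holds (n := ((2 ^ M : ℕ) : ℤ))
      (by exact_mod_cast pow_ne_zero M two_ne_zero) Q
  -- the `M₀`-clause in `E(K)`: `2^M Q ≠ 2^{M−1−M₀} P₀`, and `2^M Q = 2^{M−M₀} P₀` for some `Q`
  have hyM : ∀ Q : (W.baseChange K).toAffine.Point,
      ((2 ^ M : ℕ) : ℤ) • Q ≠ ((((2 : ℕ) : ℤ) ^ (M - 1 - M₀))) • P₀ :=
    two_pow_smul_ne_of_not_divisible_ringClassField W hK hodd hH hsurj ι hP₀K (by omega) hndiv₁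
  have htor1 : ∀ (L : ℕ) (R : (W.baseChange (ringClassField K ι 1)).toAffine.Point),
      ((2 ^ L : ℕ) : ℤ) • R = 0 → R = 0 :=
    fun L R hR ↦ CMExactDescent.eq_zero_of_two_pow_smul_eq_zero_ringClassField W hK hodd hH hsurj ι L R hR
  obtain ⟨Q₀, hQ₀⟩ : ∃ Q : (W.baseChange K).toAffine.Point, ((2 ^ M₀ : ℕ) : ℤ) • Q = P₀ :=
    (Summit.BirchSwinnertonDyer.Rank1Residual.X11b.Three.Koly.pDiv_one_iff_exists_zsmul_eq hK d₁ P₀ hP₀K 2 M₀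
      (htor1 M₀)).mp hdiv₁
  have hyeM : ∃ Q : (W.baseChange K).toAffine.Point,
      ((2 ^ M : ℕ) : ℤ) • Q = ((((2 : ℕ) : ℤ) ^ (M - 1 - M₀ + 1))) • P₀ := by
    refine ⟨Q₀, ?_⟩
    rw [← hQ₀, smul_smul, ← Nat.cast_pow, ← Nat.cast_mul, ← pow_add,
      show M - 1 - M₀ + 1 + M₀ = M by omega]
  -- a Selmer lift of `d` at level `2^M` (Kummer sequence; `2^M d = 0` since `j ≤ M`)
  have hdM : ((2 ^ M : ℕ) : ℤ) • (d : (W.baseChange K).galH1) = 0 := by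
    have h : 2 ^ M • d = 0 := by
      rw [show M = (M - j) + j by omega, pow_add, mul_nsmul', hj, nsmul_zero]
    rw [natCast_zsmul, ← AddSubgroupClass.coe_nsmul, h, ZeroMemClass.coe_zero]
  have hmem : (d : (W.baseChange K).galH1) ∈ (W.baseChange K).sha ⊓
      AddSubgroup.torsionBy (W.baseChange K).galH1 ((2 ^ M : ℕ) : ℤ) :=
    ⟨d.2, by exact hdM⟩
  rw [← (W.baseChange K).map_torsionH1ToH1_selmerGroup_holds
    (by exact_mod_cast pow_ne_zero M two_ne_zero)] at hmem
  obtain ⟨s, hs, hsd⟩ := hmem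
  -- Kolyvagin's annihilator at `2`, modulo print
  obtain ⟨r, hr⟩ := exists_two_pow_smul_eq_zsmul_of_cmInert_of_printedInputs W hCM hin hsurj hK hodd h3 hH
    hheeg hPinf hc hM (a := M - 1 - M₀) (by omega) hyM hyeM h372 hGZ31 hdivM hs
  rw [show M - (M - 1 - M₀) + (M - (M - 1 - M₀) - 1) + 1 = 2 * M₀ + 2 by omega] at hr
  -- push to `Ш`: the Kummer class dies there
  have h0 : ((((2 : ℕ) : ℤ) ^ (2 * M₀ + 2))) • (d : (W.baseChange K).galH1) = 0 := by
    rw [← hsd, ← map_zsmul, hr, map_zsmul, torsionH1ToH1_kummerMapTorsion, zsmul_zero]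
  have h1 : ((2 ^ (2 * M₀ + 2) • d : (W.baseChange K).sha) : (W.baseChange K).galH1) = 0 := by
    rw [AddSubgroupClass.coe_nsmul, ← h0, ← natCast_zsmul]
    norm_cast
  exact Subtype.ext h1

end Summit.BirchSwinnertonDyer.BirchSwinnertonDyer.Theorems.KolyvaginDescentTwo

end
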